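import Literature.Barriers.CriticalPhenomena.GridSAWStructuredDrawing
import HarnessLib

/-!
# Grid drawings assembled from tiles

A way to certify large, uniformly generated grid drawings (`SDrawing`, `GridSAWStructuredDrawing.lean`)
by FINITE checks: the drawing is cut into translated copies of finitely many **tiles** — closed
boxes `[0, w] × [0, h]` carrying vertices and drawn edges in local coordinates — such that

* every drawn edge lies in one tile (`Tile.Valid`: the local conditions of `SDrawing.IsValid`, plus:
  a path touches the RESTRICTED sides of its box (top, and left — right for mirrored tiles) only at
  vertex positions and avoids the corners, no vertex sits at a corner, no edge has both ends on the
  boundary, and local degrees are within a budget);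
* distinct tiles meet only along their boundaries, where one of the two is restricted (`boxes`), a
  vertex of a tile inside another tile's box is listed by both (`crosslist`), coinciding vertex
  positions are the same global vertex (`shared`), every global vertex is placed (`cover`),
  positions agree with the global position function (`pos_eq`), and global degrees are at most
  three (`degree`).

Then the assembled drawing is valid (`assemble_isValid`). `Tile.Valid` is decidable, so each tile
is certified by `decide`; the remaining hypotheses are arithmetic on the translations.

## References

* M. Liśkiewicz, M. Ogihara, S. Toda, TCS 304 (2003) 129–156, §4 (proof of Theorem 7: the grid
  embedding `E₀` with vertex-disjoint edge paths).
-/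

namespace Literature.Barriers.CriticalPhenomena.GridSAW

/-! ### Tiles -/

/-- **A tile**: a closed box `[0, w] × [0, h]` with local vertices `0, …, |pos| - 1` at the points
`pos`, local drawn edges `(i, j, π)` and a degree budget per local vertex. [folklore] -/
structure Tile where
  /-- width of the box -/
  w : ℕ
  /-- height of the box -/
  h : ℕ
  /-- mirrored tiles have their restricted vertical side on the right (`x = w`), the others on the left (`x = 0`) -/
  mirrored : Bool
  /-- positions of the local vertices -/
  pos : List GridPoint
  /-- local drawn edges -/
  edges : List (ℕ × ℕ × List GridPoint)
  /-- degree budget of each local vertex -/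
  bud : List ℕ

namespace Tile

variable (T : Tile)

/-- Number of local vertices. [folklore] -/
abbrev nv : ℕ := T.pos.length

/-- The closed box of the tile. [folklore] -/
def InBox (p : GridPoint) : Prop := 0 ≤ p.1 ∧ p.1 ≤ T.w ∧ 0 ≤ p.2 ∧ p.2 ≤ T.h

/-- The boundary of the box. [folklore] -/
def OnBdry (p : GridPoint) : Prop := p.1 = 0 ∨ p.1 = T.w ∨ p.2 = 0 ∨ p.2 = T.h

/-- The corners of the box. [folklore] -/
def IsCorner (p : GridPoint) : Prop := (p.1 = 0 ∨ p.1 = T.w) ∧ (p.2 = 0 ∨ p.2 = T.h)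

/-- **The restricted part of the boundary**: the top side and one vertical side (left, or right for a
mirrored tile). Paths may touch it only at vertex positions; the opposite sides are free (the
neighbouring tile is restricted there), so two neighbours never compete for a boundary point. [folklore] -/
def Restr (p : GridPoint) : Prop := p.2 = T.h ∨ (if T.mirrored then p.1 = T.w else p.1 = 0)

/-- The local degree of local vertex `i`. [folklore] -/
def ldeg (i : ℕ) : ℕ := T.edges.countP fun e => decide (e.1 = i ∨ e.2.1 = i)

/-- Membership in the box is decidable. [folklore] -/
instance (p : GridPoint) : Decidable (T.InBox p) := by unfold InBox; infer_instance

/-- Membership in the boundary is decidable. [folklore] -/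
instance (p : GridPoint) : Decidable (T.OnBdry p) := by unfold OnBdry; infer_instance

/-- Being a corner is decidable. [folklore] -/
instance (p : GridPoint) : Decidable (T.IsCorner p) := by unfold IsCorner; infer_instance

/-- Being restricted is decidable. [folklore] -/
instance (p : GridPoint) : Decidable (T.Restr p) := by unfold Restr; infer_instance

/-- The conditions on one local edge of a valid tile. [folklore] -/
def EdgeOK (e : ℕ × ℕ × List GridPoint) : Prop :=
  e.1 < T.nv ∧ e.2.1 < T.nv ∧ e.1 ≠ e.2.1 ∧
    e.2.2.head? = T.pos[e.1]? ∧ e.2.2.getLast? = T.pos[e.2.1]? ∧ e.2.2.Nodup ∧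
    List.IsChain IsGridEdge e.2.2 ∧
    (∀ p ∈ e.2.2, T.InBox p ∧ ¬ T.IsCorner p ∧ (p ∈ T.pos → T.pos[e.1]? = some p ∨ T.pos[e.2.1]? = some p) ∧
      (T.Restr p → p ∈ T.pos)) ∧
    ¬ ((∀ p ∈ T.pos[e.1]?, T.OnBdry p) ∧ (∀ p ∈ T.pos[e.2.1]?, T.OnBdry p))

/-- The edge conditions are decidable. [folklore] -/
instance (e : ℕ × ℕ × List GridPoint) : Decidable (T.EdgeOK e) := by unfold EdgeOK; infer_instance

/-- Key of a grid point of the box (injective on the box; used only through equality of keys of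
equal points). [folklore] -/
def key (p : GridPoint) : ℕ := p.1.toNat * (T.h + 1) + p.2.toNat

/-- The keys of the path points that are not vertex positions, edge after edge. [folklore] -/
def interiorKeys : List ℕ :=
  T.edges.flatMap fun e => (e.2.2.filter fun p => decide (p ∉ T.pos)).map T.key

/-- **Duplicate-freeness by a bit set** (kernel-friendly: one pass, `Nat` bit operations). [folklore] -/
def bitNodup : List ℕ → ℕ → Bool
  | [], _ => true
  | k :: ks, acc => (!acc.testBit k) && bitNodup ks (acc ||| 2 ^ k)

/-- **Validity of a tile** (a finite check): vertices in the box, off the corners, at distinct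
points; every edge joins distinct local vertices by a self-avoiding grid path inside the box from the
first to the second, off the corners, meeting vertex positions only at its ends and the restricted
sides only at vertex positions, not both ends on the boundary; no parallel edges; no grid point off the vertex positions
on two edges (checked through a bit set of keys); local degrees within budget, budgets at most three.
[folklore] -/
def Valid (T : Tile) : Prop :=
  (∀ p ∈ T.pos, T.InBox p ∧ ¬ T.IsCorner p) ∧
  T.pos.Nodup ∧
  (∀ e ∈ T.edges, T.EdgeOK e) ∧
  T.edges.Pairwise (fun e e' => ¬ ((e.1 = e'.1 ∧ e.2.1 = e'.2.1) ∨ (e.1 = e'.2.1 ∧ e.2.1 = e'.1))) ∧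
  bitNodup T.interiorKeys 0 = true ∧
  (∀ i < T.nv, T.ldeg i ≤ T.bud.getD i 0 ∧ T.bud.getD i 0 ≤ 3)

/-- Validity of a tile is decidable (certified by `decide`, tile by tile). [folklore] -/
instance : Decidable T.Valid := by unfold Valid; infer_instance

end Tile

/-! ### Placements and the assembled drawing -/

/-- **A placed tile**: the tile, the translation, and the global names of its local vertices. [folklore] -/
structure Placement where
  /-- the tile -/
  T : Tile
  /-- the translation (global coordinates of the local origin) -/
  o : GridPoint
  /-- the global vertex of each local vertex -/
  ν : ℕ → ℕ

namespace Placement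

variable (P : Placement)

/-- Local to global coordinates. [folklore] -/
def shift (p : GridPoint) : GridPoint := (P.o.1 + p.1, P.o.2 + p.2)

/-- The drawn edges of the placed tile, in global names and coordinates. [folklore] -/
def gedges : List (SEdge ℕ) := P.T.edges.map fun e => (P.ν e.1, P.ν e.2.1, e.2.2.map P.shift)

/-- The closed box of the placed tile. [folklore] -/
def Box (q : GridPoint) : Prop := P.T.InBox (q.1 - P.o.1, q.2 - P.o.2)

/-- The boundary of the placed tile. [folklore] -/
def Bdry (q : GridPoint) : Prop := P.T.OnBdry (q.1 - P.o.1, q.2 - P.o.2)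

/-- The restricted sides of the placed tile. [folklore] -/
def RestrG (q : GridPoint) : Prop := P.T.Restr (q.1 - P.o.1, q.2 - P.o.2)

/-- `shift` is injective. [folklore] -/
theorem shift_injective : Function.Injective P.shift := by
  intro p q h
  simp only [shift, Prod.mk.injEq] at h
  exact Prod.ext (by omega) (by omega)

/-- `shift` preserves grid adjacency. [folklore] -/
theorem isGridEdge_shift {p q : GridPoint} : IsGridEdge (P.shift p) (P.shift q) ↔ IsGridEdge p q := by
  unfold IsGridEdge shift
  simp only
  constructor
  · rintro (⟨h1, h2⟩ | ⟨h1, h2⟩)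
    · left; refine ⟨by omega, ?_⟩; rwa [show P.o.2 + p.2 - (P.o.2 + q.2) = p.2 - q.2 by ring] at h2
    · right; refine ⟨by omega, ?_⟩; rwa [show P.o.1 + p.1 - (P.o.1 + q.1) = p.1 - q.1 by ring] at h2
  · rintro (⟨h1, h2⟩ | ⟨h1, h2⟩)
    · left; refine ⟨by omega, ?_⟩; rwa [show P.o.2 + p.2 - (P.o.2 + q.2) = p.2 - q.2 by ring]
    · right; refine ⟨by omega, ?_⟩; rwa [show P.o.1 + p.1 - (P.o.1 + q.1) = p.1 - q.1 by ring]

/-- The box of the placed tile in local coordinates. [folklore] -/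
theorem box_shift {p : GridPoint} : P.Box (P.shift p) ↔ P.T.InBox p := by
  unfold Box shift; simp

/-- The boundary of the placed tile in local coordinates. [folklore] -/
theorem bdry_shift {p : GridPoint} : P.Bdry (P.shift p) ↔ P.T.OnBdry p := by
  unfold Bdry shift; simp

/-- The restricted sides of the placed tile in local coordinates. [folklore] -/
theorem restrG_shift {p : GridPoint} : P.RestrG (P.shift p) ↔ P.T.Restr p := by
  unfold RestrG shift; simp

/-- Members of `gedges`. [folklore] -/
theorem mem_gedges_iff {d : SEdge ℕ} :
    d ∈ P.gedges ↔ ∃ e ∈ P.T.edges, d = (P.ν e.1, P.ν e.2.1, e.2.2.map P.shift) := by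
  unfold gedges; rw [List.mem_map]
  constructor
  · rintro ⟨e, he, rfl⟩; exact ⟨e, he, rfl⟩
  · rintro ⟨e, he, rfl⟩; exact ⟨e, he, rfl⟩

end Placement

/-- **The drawing assembled from placed tiles**: vertices `0, …, nV - 1` at `gpos`, all the placed
edges. [folklore] -/
def assemble (L : List Placement) (nV : ℕ) (gpos : ℕ → GridPoint) : SDrawing ℕ where
  verts := List.range nV
  pos := gpos
  edges := L.flatMap Placement.gedges

/-- Members of the assembled edge list. [folklore] -/
theorem mem_assemble_edges {L : List Placement} {nV : ℕ} {gpos : ℕ → GridPoint} {d : SEdge ℕ} :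
    d ∈ (assemble L nV gpos).edges ↔ ∃ P ∈ L, ∃ e ∈ P.T.edges, d = (P.ν e.1, P.ν e.2.1, e.2.2.map P.shift) := by
  unfold assemble
  rw [List.mem_flatMap]
  constructor
  · rintro ⟨P, hP, hd⟩; exact ⟨P, hP, (P.mem_gedges_iff).1 hd⟩
  · rintro ⟨P, hP, h⟩; exact ⟨P, hP, (P.mem_gedges_iff).2 h⟩

/-! ### Consequences of tile validity -/

namespace Tile

variable {T : Tile}

/-- A listed position is some `pos[i]`. [folklore] -/
theorem exists_getElem_of_mem {p : GridPoint} (hp : p ∈ T.pos) : ∃ i, ∃ hi : i < T.nv, T.pos[i] = p :=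
  List.getElem_of_mem hp

/-- Accessors of a valid tile's edge conditions. [folklore] -/
theorem Valid.edge (hT : T.Valid) {e : ℕ × ℕ × List GridPoint} (he : e ∈ T.edges) :
    e.1 < T.nv ∧ e.2.1 < T.nv ∧ e.1 ≠ e.2.1 ∧
      e.2.2.head? = T.pos[e.1]? ∧ e.2.2.getLast? = T.pos[e.2.1]? ∧ e.2.2.Nodup ∧
      List.IsChain IsGridEdge e.2.2 ∧
      (∀ p ∈ e.2.2, T.InBox p ∧ ¬ T.IsCorner p ∧ (p ∈ T.pos → T.pos[e.1]? = some p ∨ T.pos[e.2.1]? = some p) ∧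
        (T.Restr p → p ∈ T.pos)) ∧
      ¬ ((∀ p ∈ T.pos[e.1]?, T.OnBdry p) ∧ (∀ p ∈ T.pos[e.2.1]?, T.OnBdry p)) :=
  hT.2.2.1 e he

/-- In a valid tile, a path point that is a vertex position is an end of the edge. [folklore] -/
theorem Valid.eq_end_of_mem (hT : T.Valid) {e : ℕ × ℕ × List GridPoint} (he : e ∈ T.edges) {p : GridPoint}
    (hp : p ∈ e.2.2) (hpos : p ∈ T.pos) :
    (T.pos[e.1]'(hT.edge he).1 = p) ∨ (T.pos[e.2.1]'(hT.edge he).2.1 = p) := by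
  have h := ((hT.edge he).2.2.2.2.2.2.2.1 p hp).2.2.1 hpos
  simp only [List.getElem?_eq_getElem (hT.edge he).1, List.getElem?_eq_getElem (hT.edge he).2.1,
    Option.some.injEq] at h
  exact h

/-- **Soundness of the bit-set check**: the keys are pairwise distinct (and none was set before). [folklore] -/
theorem nodup_of_bitNodup : ∀ {l : List ℕ} {acc : ℕ}, bitNodup l acc = true → l.Nodup ∧ ∀ k ∈ l, acc.testBit k = false
  | [], _, _ => ⟨List.nodup_nil, fun _ h => by simp at h⟩
  | k :: ks, acc, h => by
    simp only [bitNodup, Bool.and_eq_true, Bool.not_eq_true'] at h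
    obtain ⟨hk, hrest⟩ := h
    obtain ⟨hnd, hacc⟩ := nodup_of_bitNodup hrest
    have hacc' : ∀ j ∈ ks, acc.testBit j = false ∧ j ≠ k := fun j hj => by
      have := hacc j hj
      rw [Nat.testBit_lor, Bool.or_eq_false_iff, Nat.testBit_two_pow] at this
      exact ⟨this.1, fun hjk => by simp [hjk] at this⟩
    refine ⟨List.nodup_cons.2 ⟨fun hmem => (hacc' k hmem).2 rfl, hnd⟩, fun j hj => ?_⟩
    rcases List.mem_cons.1 hj with rfl | hj
    · exact hk
    · exact (hacc' j hj).1

/-- **In a valid tile, a common point of two edges is a vertex position.** [folklore] -/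
theorem Valid.pairwise_common (hT : T.Valid) :
    T.edges.Pairwise (fun e e' => ∀ p ∈ e.2.2, p ∈ e'.2.2 → p ∈ T.pos) := by
  have hnd : T.interiorKeys.Nodup := (nodup_of_bitNodup hT.2.2.2.2.1).1
  unfold interiorKeys at hnd
  rw [List.nodup_flatMap] at hnd
  refine hnd.2.imp fun {e e'} hdis p hp hp' => ?_
  by_contra hnot
  refine hdis ?_ ?_ (a := T.key p)
  · exact List.mem_map.2 ⟨p, List.mem_filter.2 ⟨hp, by simpa using hnot⟩, rfl⟩
  · exact List.mem_map.2 ⟨p, List.mem_filter.2 ⟨hp', by simpa using hnot⟩, rfl⟩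

end Tile

/-! ### Validity of the assembled drawing -/

section assemble

variable {L : List Placement} {nV : ℕ} {gpos : ℕ → GridPoint}

/-- The hypotheses on a tiling. [folklore] -/
structure TilingHyps (L : List Placement) (nV : ℕ) (gpos : ℕ → GridPoint) : Prop where
  /-- no placement listed twice -/
  nodup : L.Nodup
  /-- every tile is valid -/
  valid : ∀ P ∈ L, P.T.Valid
  /-- local vertices are global vertices at the translated positions -/
  pos_eq : ∀ P ∈ L, ∀ i (hi : i < P.T.nv), P.ν i < nV ∧ gpos (P.ν i) = P.shift P.T.pos[i]
  /-- distinct tiles meet only along their boundaries, and there one of the two is restricted -/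
  boxes : ∀ P ∈ L, ∀ Q ∈ L, P ≠ Q → ∀ q, P.Box q → Q.Box q → (P.Bdry q ∧ Q.Bdry q) ∧ (P.RestrG q ∨ Q.RestrG q)
  /-- a vertex of a tile lying in another tile's box is a vertex of that tile too -/
  crosslist : ∀ P ∈ L, ∀ Q ∈ L, ∀ j (hj : j < Q.T.nv), P.Box (Q.shift Q.T.pos[j]) →
    ∃ i, ∃ hi : i < P.T.nv, P.shift P.T.pos[i] = Q.shift Q.T.pos[j]
  /-- coinciding positions are the same global vertex -/
  shared : ∀ P ∈ L, ∀ Q ∈ L, ∀ i (hi : i < P.T.nv), ∀ j (hj : j < Q.T.nv),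
    P.shift P.T.pos[i] = Q.shift Q.T.pos[j] → P.ν i = Q.ν j
  /-- every global vertex is placed -/
  cover : ∀ v < nV, ∃ P ∈ L, ∃ i, i < P.T.nv ∧ P.ν i = v
  /-- global degrees -/
  degree : ∀ v < nV, (assemble L nV gpos).degree v ≤ 3

/-- The global names of a placement are injective on its local vertices. [folklore] -/
theorem TilingHyps.ν_inj (H : TilingHyps L nV gpos) {P : Placement} (hP : P ∈ L) {i j : ℕ}
    (hi : i < P.T.nv) (hj : j < P.T.nv) (h : P.ν i = P.ν j) : i = j := by
  have h1 := (H.pos_eq P hP i hi).2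
  have h2 := (H.pos_eq P hP j hj).2
  rw [h] at h1
  have := P.shift_injective (h1.symm.trans h2)
  exact (List.Nodup.getElem_inj_iff (H.valid P hP).2.1).1 this

/-- **A path point of a placed edge that is a global vertex position is a local vertex position of
the same tile** (inside the tile: only at listed points; from another tile: only on the boundary,
where path points are listed points). [folklore] -/
theorem TilingHyps.mem_pos_of_point (H : TilingHyps L nV gpos) {P : Placement} (hP : P ∈ L)
    {e : ℕ × ℕ × List GridPoint} (he : e ∈ P.T.edges) {p : GridPoint} (hp : p ∈ e.2.2)
    {Q : Placement} (hQ : Q ∈ L) {j : ℕ} (hj : j < Q.T.nv) (heq : P.shift p = Q.shift Q.T.pos[j]) :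
    p ∈ P.T.pos := by
  have hT := H.valid P hP
  obtain ⟨hbox, -, -, -⟩ := (hT.edge he).2.2.2.2.2.2.2.1 p hp
  have hq1 : P.Box (Q.shift Q.T.pos[j]) := by rw [← heq]; exact P.box_shift.2 hbox
  obtain ⟨i, hi, hieq⟩ := H.crosslist P hP Q hQ j hj hq1
  rw [← heq] at hieq
  rw [← P.shift_injective hieq]
  exact List.getElem_mem hi

/-- **A common point of edges of two distinct placed tiles is a local vertex position.** [folklore] -/
theorem TilingHyps.mem_pos_of_common (H : TilingHyps L nV gpos) {P Q : Placement} (hP : P ∈ L) (hQ : Q ∈ L)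
    (hPQ : P ≠ Q) {e e' : ℕ × ℕ × List GridPoint} (he : e ∈ P.T.edges) (he' : e' ∈ Q.T.edges)
    {p p' : GridPoint} (hp : p ∈ e.2.2) (hp' : p' ∈ e'.2.2) (heq : P.shift p = Q.shift p') : p ∈ P.T.pos := by
  obtain ⟨hbox, -, -, hbd⟩ := ((H.valid P hP).edge he).2.2.2.2.2.2.2.1 p hp
  obtain ⟨hbox', -, -, hbd'⟩ := ((H.valid Q hQ).edge he').2.2.2.2.2.2.2.1 p' hp'
  have hq1 : P.Box (P.shift p) := P.box_shift.2 hbox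
  have hq2 : Q.Box (P.shift p) := by rw [heq]; exact Q.box_shift.2 hbox'
  rcases (H.boxes P hP Q hQ hPQ _ hq1 hq2).2 with hr | hr
  · exact hbd (P.restrG_shift.1 hr)
  · -- restricted for `Q`: a vertex position of `Q` inside the box of `P`, hence one of `P`
    have hp'pos : p' ∈ Q.T.pos := hbd' (Q.restrG_shift.1 (by rwa [heq] at hr))
    obtain ⟨j, hj, rfl⟩ := Tile.exists_getElem_of_mem hp'pos
    obtain ⟨i, hi, hieq⟩ := H.crosslist P hP Q hQ j hj (by rw [← heq]; exact hq1)
    rw [← heq] at hieq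
    rw [← P.shift_injective hieq]
    exact List.getElem_mem hi

/-- A local vertex position is a global vertex position. [folklore] -/
theorem TilingHyps.exists_vertex_of_mem_pos (H : TilingHyps L nV gpos) {P : Placement} (hP : P ∈ L)
    {p : GridPoint} (hp : p ∈ P.T.pos) : ∃ v ∈ (assemble L nV gpos).verts, (assemble L nV gpos).pos v = P.shift p := by
  obtain ⟨i, hi, rfl⟩ := Tile.exists_getElem_of_mem hp
  obtain ⟨hlt, hpos⟩ := H.pos_eq P hP i hi
  exact ⟨P.ν i, List.mem_range.2 hlt, hpos⟩

/-- **The drawing assembled from a tiling satisfying the hypotheses is valid.**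
[cite: LiskiewiczOgiharaToda2003, §4 (proof of Theorem 7, E₀)] -/
theorem assemble_isValid (H : TilingHyps L nV gpos) : (assemble L nV gpos).IsValid := by
  have hverts : (assemble L nV gpos).verts = List.range nV := rfl
  have hposf : (assemble L nV gpos).pos = gpos := rfl
  refine ⟨List.nodup_range, ?_, ?_, ?_, ?_, ?_, ?_, ?_, ?_, ?_, ?_, ?_, fun v hv => H.degree v (List.mem_range.1 hv)⟩
  · -- distinct vertices at distinct points
    intro a ha b hb hab
    rw [hverts, List.mem_range] at ha hb
    obtain ⟨P, hP, i, hi, rfl⟩ := H.cover a ha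
    obtain ⟨Q, hQ, j, hj, rfl⟩ := H.cover b hb
    rw [hposf, (H.pos_eq P hP i hi).2, (H.pos_eq Q hQ j hj).2] at hab
    exact H.shared P hP Q hQ i hi j hj hab
  · -- first ends listed
    intro d hd
    obtain ⟨P, hP, e, he, rfl⟩ := mem_assemble_edges.1 hd
    exact List.mem_range.2 (H.pos_eq P hP _ ((H.valid P hP).edge he).1).1
  · intro d hd
    obtain ⟨P, hP, e, he, rfl⟩ := mem_assemble_edges.1 hd
    exact List.mem_range.2 (H.pos_eq P hP _ ((H.valid P hP).edge he).2.1).1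
  · -- no loops
    intro d hd
    obtain ⟨P, hP, e, he, rfl⟩ := mem_assemble_edges.1 hd
    have hv := (H.valid P hP).edge he
    intro h
    exact hv.2.2.1 (H.ν_inj hP hv.1 hv.2.1 h)
  · -- the path starts at the first end
    intro d hd
    obtain ⟨P, hP, e, he, rfl⟩ := mem_assemble_edges.1 hd
    have hv := (H.valid P hP).edge he
    show (e.2.2.map P.shift).head? = some (gpos (P.ν e.1))
    rw [List.head?_map, hv.2.2.2.1, List.getElem?_eq_getElem hv.1, Option.map_some, (H.pos_eq P hP _ hv.1).2]
  · intro d hd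
    obtain ⟨P, hP, e, he, rfl⟩ := mem_assemble_edges.1 hd
    have hv := (H.valid P hP).edge he
    show (e.2.2.map P.shift).getLast? = some (gpos (P.ν e.2.1))
    rw [List.getLast?_map, hv.2.2.2.2.1, List.getElem?_eq_getElem hv.2.1, Option.map_some, (H.pos_eq P hP _ hv.2.1).2]
  · -- self-avoiding
    intro d hd
    obtain ⟨P, hP, e, he, rfl⟩ := mem_assemble_edges.1 hd
    exact ((H.valid P hP).edge he).2.2.2.2.2.1.map P.shift_injective
  · -- grid paths
    intro d hd
    obtain ⟨P, hP, e, he, rfl⟩ := mem_assemble_edges.1 hd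
    show List.IsChain IsGridEdge (e.2.2.map P.shift)
    rw [List.isChain_map]
    exact ((H.valid P hP).edge he).2.2.2.2.2.2.1.imp fun a b h => P.isGridEdge_shift.2 h
  · -- paths meet vertex positions only at their ends
    intro d hd v hv hmem
    obtain ⟨P, hP, e, he, rfl⟩ := mem_assemble_edges.1 hd
    rw [hverts, List.mem_range] at hv
    obtain ⟨Q, hQ, j, hj, rfl⟩ := H.cover v hv
    change gpos (Q.ν j) ∈ e.2.2.map P.shift at hmem
    rw [(H.pos_eq Q hQ j hj).2, List.mem_map] at hmem
    obtain ⟨p, hp, heq⟩ := hmem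
    have hpos : p ∈ P.T.pos := H.mem_pos_of_point hP he hp hQ hj heq
    have hT := H.valid P hP
    rcases hT.eq_end_of_mem he hp hpos with h | h
    · left
      show Q.ν j = P.ν e.1
      refine (H.shared P hP Q hQ _ (hT.edge he).1 j hj ?_).symm
      rw [h, heq]
    · right
      show Q.ν j = P.ν e.2.1
      refine (H.shared P hP Q hQ _ (hT.edge he).2.1 j hj ?_).symm
      rw [h, heq]
  · -- no parallel edges
    unfold assemble
    rw [List.pairwise_flatMap]
    constructor
    · intro P hP
      unfold Placement.gedges
      rw [List.pairwise_map]
      have hT := H.valid P hP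
      refine hT.2.2.2.1.imp_of_mem fun {e e'} he he' hne => ?_
      unfold SDrawing.SameEndsS
      simp only
      rintro (⟨h1, h2⟩ | ⟨h1, h2⟩)
      · exact hne (Or.inl ⟨H.ν_inj hP (hT.edge he).1 (hT.edge he').1 h1, H.ν_inj hP (hT.edge he).2.1 (hT.edge he').2.1 h2⟩)
      · exact hne (Or.inr ⟨H.ν_inj hP (hT.edge he).1 (hT.edge he').2.1 h1, H.ν_inj hP (hT.edge he).2.1 (hT.edge he').1 h2⟩)
    · refine List.Pairwise.imp_of_mem ?_ H.nodup
      intro P Q hP hQ hPQ d hd d' hd' hsame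
      obtain ⟨e, he, rfl⟩ := P.mem_gedges_iff.1 hd
      obtain ⟨e', he', rfl⟩ := Q.mem_gedges_iff.1 hd'
      have hT := H.valid P hP
      have hv := hT.edge he
      have hv' := (H.valid Q hQ).edge he'
      -- both ends of `e` are shared with `Q`, hence on the boundary of `P`: excluded
      apply hv.2.2.2.2.2.2.2.2
      have key : ∀ {i j : ℕ} (hi : i < P.T.nv) (hj : j < Q.T.nv), P.ν i = Q.ν j →
          ∀ p ∈ P.T.pos[i]?, P.T.OnBdry p := by
        intro i j hi hj hij p hp
        rw [List.getElem?_eq_getElem hi, Option.mem_def, Option.some.injEq] at hp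
        subst hp
        have h1 := (H.pos_eq P hP i hi).2
        have h2 := (H.pos_eq Q hQ j hj).2
        rw [hij] at h1
        have heq := h1.symm.trans h2
        have hq1 : P.Box (P.shift P.T.pos[i]) := P.box_shift.2 (hT.1 _ (List.getElem_mem hi)).1
        have hq2 : Q.Box (P.shift P.T.pos[i]) := by
          rw [heq]; exact Q.box_shift.2 ((H.valid Q hQ).1 _ (List.getElem_mem hj)).1
        exact P.bdry_shift.1 (H.boxes P hP Q hQ hPQ _ hq1 hq2).1.1
      unfold SDrawing.SameEndsS at hsame
      simp only at hsame
      rcases hsame with ⟨h1, h2⟩ | ⟨h1, h2⟩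
      · exact ⟨key hv.1 hv'.1 h1, key hv.2.1 hv'.2.1 h2⟩
      · exact ⟨key hv.1 hv'.2.1 h1, key hv.2.1 hv'.1 h2⟩
  · -- congestion-free
    unfold assemble
    rw [List.pairwise_flatMap]
    constructor
    · intro P hP
      unfold Placement.gedges
      rw [List.pairwise_map]
      have hT := H.valid P hP
      refine hT.pairwise_common.imp_of_mem fun {e e'} he he' hcommon q hq hq' => ?_
      simp only [List.mem_map] at hq hq'
      obtain ⟨p, hp, rfl⟩ := hq
      obtain ⟨p', hp', heq⟩ := hq'
      rw [P.shift_injective heq] at hp'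
      exact H.exists_vertex_of_mem_pos hP (hcommon p hp hp')
    · refine List.Pairwise.imp_of_mem ?_ H.nodup
      intro P Q hP hQ hPQ d hd d' hd' q hq hq'
      obtain ⟨e, he, rfl⟩ := P.mem_gedges_iff.1 hd
      obtain ⟨e', he', rfl⟩ := Q.mem_gedges_iff.1 hd'
      simp only [List.mem_map] at hq hq'
      obtain ⟨p, hp, rfl⟩ := hq
      obtain ⟨p', hp', heq⟩ := hq'
      exact H.exists_vertex_of_mem_pos hP (H.mem_pos_of_common hP hQ hPQ he he' hp hp' heq.symm)

end assemble

/-! ### Degrees of the assembled drawing -/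

/-- The degree in the assembled drawing is the sum of the degrees in the placed tiles. [folklore] -/
theorem degree_assemble (L : List Placement) (nV : ℕ) (gpos : ℕ → GridPoint) (v : ℕ) :
    (assemble L nV gpos).degree v = (L.map fun P => P.gedges.countP fun e => decide (e.1 = v ∨ e.2.1 = v)).sum := by
  unfold SDrawing.degree assemble
  simp only
  rw [List.countP_flatMap]
  rfl

/-- The degree in a placed tile at a global vertex not among its names is zero. [folklore] -/
theorem countP_gedges_eq_zero (P : Placement) {v : ℕ} (hT : P.T.Valid) (hv : ∀ i < P.T.nv, P.ν i ≠ v) :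
    (P.gedges.countP fun e => decide (e.1 = v ∨ e.2.1 = v)) = 0 := by
  rw [List.countP_eq_zero]
  intro d hd
  obtain ⟨e, he, rfl⟩ := P.mem_gedges_iff.1 hd
  have h := hT.edge he
  simp only [decide_eq_true_eq, not_or]
  exact ⟨hv _ h.1, hv _ h.2.1⟩

/-- The degree in a placed tile at the global vertex of local vertex `i` is the local degree (names
injective on local vertices). [folklore] -/
theorem countP_gedges_eq_ldeg (P : Placement) (hT : P.T.Valid) {i : ℕ} (hi : i < P.T.nv)
    (hinj : ∀ j < P.T.nv, P.ν j = P.ν i → j = i) :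
    (P.gedges.countP fun e => decide (e.1 = P.ν i ∨ e.2.1 = P.ν i)) = P.T.ldeg i := by
  unfold Placement.gedges Tile.ldeg
  rw [List.countP_map]
  refine List.countP_congr fun e he => ?_
  have h := hT.edge he
  simp only [Function.comp_apply, decide_eq_true_eq]
  constructor
  · rintro (h1 | h1)
    · exact Or.inl (hinj _ h.1 h1)
    · exact Or.inr (hinj _ h.2.1 h1)
  · rintro (rfl | rfl)
    · exact Or.inl rfl
    · exact Or.inr rfl

/-- The local degree is within the budget. [folklore] -/
theorem Tile.Valid.ldeg_le {T : Tile} (hT : T.Valid) {i : ℕ} (hi : i < T.nv) : T.ldeg i ≤ T.bud.getD i 0 ∧ T.bud.getD i 0 ≤ 3 :=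
  hT.2.2.2.2.2 i hi

end Literature.Barriers.CriticalPhenomena.GridSAW
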